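import Summits.NavierStokesRegularity.NavierStokesRegularity.Theorems.PerpetualPumpAveragedTypeIBlowupChainContinuationTools
import Mathlib.MeasureTheory.Integral.DominatedConvergence
import Mathlib.Topology.ContinuousMap.Bounded.Normed
import Mathlib.Topology.MetricSpace.Contracting
import Mathlib.Topology.Order.ProjIcc

/-!
# Crux `PerpetualPump.AveragedTypeIBlowup` (stmt-NavierStokesRegularity-1835), line `Sketch`:
# the stub `chainContinuation` — local well-posedness of the Volterra chain (Picard)

T. Tao, *Finite time blowup for an averaged three-dimensional Navier–Stokes equation*, J. Amer.
Math. Soc. **29** (2016), 601–674 = arXiv:1402.0290v3, §4, p. 22 (4.14): the coefficients of a mild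
solution of the cascade equation solve the exact Volterra chain
`Y_{i,n}(t) = A 1_{(i,n)=(i₀,n₀)} k_{i,n}(t) + ∫₀ᵗ k_{i,n}(t-s) quadTerm(Y)_{i,n}(s) ds`, `|k_{i,n}| ≤ 1`.

Helper file (theorems only) for the registered stub `stub_chainContinuation` of the lead's skeleton
`Cruxes/AveragedTypeIBlowup/Lines/Sketch.lean`. It lands the registered sub-goal
`stub_chainContinuationPicard`: for continuous kernels `|k_{i,n}| ≤ 1` and a continuous forcing `F`
with `(1+ε₀)^{20n}|F_{i,n}| ≤ R` vanishing below the scale `n₀`, the restarted chain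
`X_{i,n}(t) = F_{i,n}(t) + ∫ₐᵗ k_{i,n}(t-s) quadTerm(X)_{i,n}(s) ds` has, on every interval `[a,b]` of
length at most `δ = δ(ε₀, α, n₀, R) > 0`, a continuous solution of weighted size `≤ 2R+1` vanishing
below `n₀`, unique among such solutions. The proof is Banach's fixed point theorem
(`ContractingWith.fixedPoint`) on the bounded continuous functions on `(Fin m × ℤ) × [a,b]` for the
map `f ↦ 1_{n≥n₀} (1+ε₀)^{20n} (F + ∫ₐ k quadTerm(clip f))`, a `½`-contraction by the weighted
Lipschitz bound `weighted_volterra_sub_le` of the tools file; the clip onto weighted size `2R+1`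
(`exists_clip`) is inactive on the fixed point and on every solution of that size.

Nothing here closes the item (`--supports`); no statement of the route changes.

## References

* T. Tao, J. Amer. Math. Soc. 29 (2016), 601–674, arXiv:1402.0290v3, §4 p. 22 (4.14).
  [`Tao2016AveragedNS`]
-/

noncomputable section

-- the summit namespace `…NavierStokesRegularity.NavierStokesRegularity…` is the tree convention
set_option linter.dupNamespace false

open MeasureTheory Set Filter Topology
open scoped ENNReal NNReal BoundedContinuousFunction
open Literature.Analysis.FluidPDE
open Literature.Analysis.FluidPDE.TaoCascade (quadTerm shiftSet mem_shiftSet_iff)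

namespace Summit.NavierStokesRegularity.NavierStokesRegularity.Theorems.PerpetualPumpAveragedTypeIBlowup

variable {ε₀ : ℝ} {m : ℕ}

/-! ### A clip onto `[-ρ, ρ]` -/

/-- A continuous `1`-Lipschitz retraction of `ℝ` onto `[-ρ, ρ]` (`x ↦ max(-ρ, min(x, ρ))`). [folklore] -/
theorem exists_clip {ρ : ℝ} (hρ : 0 ≤ ρ) :
    ∃ π : ℝ → ℝ, Continuous π ∧ (∀ x, |π x| ≤ ρ) ∧ (∀ x, |x| ≤ ρ → π x = x) ∧
      ∀ x y, |π x - π y| ≤ |x - y| := by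
  refine ⟨fun x => max (-ρ) (min x ρ), by fun_prop, fun x => ?_, fun x hx => ?_, fun x y => ?_⟩
  · exact abs_le.2 ⟨le_max_left _ _, max_le (by linarith) (min_le_right _ _)⟩
  · show max (-ρ) (min x ρ) = x
    rw [min_eq_left (abs_le.1 hx).2, max_eq_right (abs_le.1 hx).1]
  · calc |max (-ρ) (min x ρ) - max (-ρ) (min y ρ)| ≤ max |(-ρ) - (-ρ)| |min x ρ - min y ρ| :=
          abs_max_sub_max_le_max _ _ _ _
      _ = |min x ρ - min y ρ| := by rw [sub_self, abs_zero, max_eq_right (abs_nonneg _)]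
      _ ≤ max |x - y| |ρ - ρ| := abs_min_sub_min_le_max _ _ _ _
      _ = |x - y| := by rw [sub_self, abs_zero, max_eq_left (abs_nonneg _)]

/-! ### Local solutions of the Volterra chain by Picard iteration -/

/-- **Local well-posedness of the Volterra chain in the weight `(1+ε₀)^{20n}`** (registered sub-goal
`stub_chainContinuationPicard` of the stub `chainContinuation`). Fix structure constants `α`, a lowest
scale `n₀` and a size `R ≥ 0`. There is `δ > 0` such that for all continuous kernels `|k_{i,n}| ≤ 1`, all
continuous forcings `F_{i,n}` vanishing below `n₀` with `(1+ε₀)^{20n}|F_{i,n}| ≤ R`, and every interval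
`[a, b]` of length `≤ δ`, the equation `X_{i,n}(t) = F_{i,n}(t) + ∫ₐᵗ k_{i,n}(t-s) quadTerm(X)_{i,n}(s) ds`
has a continuous solution on `[a,b]`, vanishing below `n₀`, with `(1+ε₀)^{20n}|X_{i,n}| ≤ 2R+1`, and
every continuous solution on `[a,b]` with these two properties coincides with it there. Proof: Banach's
fixed point theorem for `f ↦ 1_{n ≥ n₀}(1+ε₀)^{20n}(F + ∫ₐ k quadTerm(clip f))` on the bounded continuous
functions on `(Fin m × ℤ) × [a,b]` (sup norm), a `½`-contraction by `weighted_volterra_sub_le` once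
`δ · 2K(2R+1)(1+ε₀)^{75/2-35n₀/2} ≤ ½`; the clip at weighted size `2R+1` is inactive on the fixed point
and on every solution of size `≤ 2R+1`. [cite: Tao2016AveragedNS, §4 p. 22 (4.14)] -/
theorem stub_chainContinuationPicard :
    ∀ {ε₀ : ℝ}, 0 < ε₀ → ∀ {m : ℕ} (α : Fin m → Fin m → Fin m → ℤ × ℤ × ℤ → ℝ) (n₀ : ℤ) (R : ℝ),
      0 ≤ R → ∃ δ : ℝ, 0 < δ ∧ ∀ (k F : Fin m → ℤ → ℝ → ℝ) (a b : ℝ), a ≤ b → b ≤ a + δ →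
        (∀ i n τ, |k i n τ| ≤ 1) → (∀ i n, Continuous (k i n)) →
        (∀ i n, Continuous (F i n)) → (∀ i n t, n < n₀ → F i n t = 0) →
        (∀ (i : Fin m) (n : ℤ) (t : ℝ), (1 + ε₀) ^ ((20 : ℝ) * n) * |F i n t| ≤ R) →
        ∃ X : Fin m → ℤ → ℝ → ℝ, (∀ i n, Continuous (X i n)) ∧ (∀ i n t, n < n₀ → X i n t = 0) ∧
          (∀ (i : Fin m) (n : ℤ) (t : ℝ), (1 + ε₀) ^ ((20 : ℝ) * n) * |X i n t| ≤ 2 * R + 1) ∧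
          (∀ (i : Fin m) (n : ℤ), ∀ t ∈ Icc a b,
            X i n t = F i n t + ∫ s in a..t, k i n (t - s) * quadTerm ε₀ α X i n s) ∧
          ∀ Z : Fin m → ℤ → ℝ → ℝ, (∀ i n, ContinuousOn (Z i n) (Icc a b)) →
            (∀ i n t, n < n₀ → Z i n t = 0) →
            (∀ (i : Fin m) (n : ℤ), ∀ t ∈ Icc a b, (1 + ε₀) ^ ((20 : ℝ) * n) * |Z i n t| ≤ 2 * R + 1) →
            (∀ (i : Fin m) (n : ℤ), ∀ t ∈ Icc a b,
              Z i n t = F i n t + ∫ s in a..t, k i n (t - s) * quadTerm ε₀ α Z i n s) →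
            ∀ (i : Fin m) (n : ℤ), ∀ t ∈ Icc a b, Z i n t = X i n t := by
  intro ε₀ hε₀ m α n₀ R hR
  have hL0 : 0 < 1 + ε₀ := by linarith
  -- constants: `K = Σ|α|`, the size `ρ = 2R+1`, the Lipschitz modulus `Λ`, the time step `δ`
  set K : ℝ := ∑ i₃ : Fin m, ∑ i₁ : Fin m, ∑ i₂ : Fin m, ∑ μ ∈ shiftSet, |α i₁ i₂ i₃ μ| with hK
  have hK0 : 0 ≤ K := by positivity
  clear_value K
  set ρ : ℝ := 2 * R + 1 with hρ
  have hρ0 : 0 < ρ := by rw [hρ]; positivity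
  clear_value ρ
  set Λ : ℝ := K * (2 * ρ) * (1 + ε₀) ^ ((75 : ℝ) / 2 - (35 : ℝ) / 2 * n₀) with hΛ
  have hΛ0 : 0 ≤ Λ := by rw [hΛ]; positivity
  clear_value Λ
  refine ⟨1 / (2 * Λ + 2), by positivity, ?_⟩
  intro k F a b hab hb hk1 hkc hFc hF0 hFR
  set δ : ℝ := 1 / (2 * Λ + 2) with hδ
  have hδ0 : 0 < δ := by rw [hδ]; positivity
  have hδΛ : δ * Λ ≤ 1 / 2 := by
    rw [hδ, div_mul_eq_mul_div, one_mul, div_le_iff₀ (by positivity)]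
    linarith
  clear_value δ
  -- the clip, the unweighting map `Xc`, the Volterra map `V`
  obtain ⟨π, hπc, hπb, hπid, hπlip⟩ := exists_clip hρ0.le
  obtain ⟨Xc, hXc⟩ : ∃ Xc : ((Fin m × ℤ) × Icc a b →ᵇ ℝ) → Fin m → ℤ → ℝ → ℝ,
      ∀ f j k' s, Xc f j k' s = (1 + ε₀) ^ (-((20 : ℝ) * k')) * π (f ((j, k'), projIcc a b hab s)) :=
    ⟨_, fun _ _ _ _ => rfl⟩
  have hXcc : ∀ f j k', Continuous (Xc f j k') := fun f j k' => by
    rw [show Xc f j k' = fun s => (1 + ε₀) ^ (-((20 : ℝ) * k')) * π (f ((j, k'), projIcc a b hab s))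
      from funext (hXc f j k')]
    exact continuous_const.mul (hπc.comp (f.continuous.comp (continuous_const.prodMk continuous_projIcc)))
  have hXcb : ∀ f j k' s, |Xc f j k' s| ≤ ρ * (1 + ε₀) ^ (-((20 : ℝ) * k')) := fun f j k' s => by
    rw [hXc, abs_mul, abs_of_pos (Real.rpow_pos_of_pos hL0 _), mul_comm]
    exact mul_le_mul_of_nonneg_right (hπb _) (Real.rpow_nonneg hL0.le _)
  have hXcd : ∀ f g j k' s, |Xc f j k' s - Xc g j k' s| ≤ dist f g * (1 + ε₀) ^ (-((20 : ℝ) * k')) :=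
    fun f g j k' s => by
      rw [hXc, hXc, ← mul_sub, abs_mul, abs_of_pos (Real.rpow_pos_of_pos hL0 _), mul_comm]
      refine mul_le_mul_of_nonneg_right ((hπlip _ _).trans ?_) (Real.rpow_nonneg hL0.le _)
      rw [← Real.dist_eq]
      exact BoundedContinuousFunction.dist_coe_le_dist _
  have hXcid : ∀ f : (Fin m × ℤ) × Icc a b →ᵇ ℝ, ‖f‖ ≤ ρ → ∀ (j : Fin m) (k' : ℤ) (s : ℝ)
      (hs : s ∈ Icc a b), Xc f j k' s = (1 + ε₀) ^ (-((20 : ℝ) * k')) * f ((j, k'), ⟨s, hs⟩) :=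
    fun f hf j k' s hs => by
      rw [hXc, projIcc_of_mem hab hs, hπid]
      rw [← Real.norm_eq_abs]
      exact (f.norm_coe_le_norm _).trans hf
  obtain ⟨V, hV⟩ : ∃ V : ((Fin m × ℤ) × Icc a b →ᵇ ℝ) → Fin m → ℤ → ℝ → ℝ, ∀ f i n t,
      V f i n t = (if n₀ ≤ n then (1 : ℝ) else 0) * ((1 + ε₀) ^ ((20 : ℝ) * n) *
        (F i n t + ∫ s in a..t, k i n (t - s) * quadTerm ε₀ α (Xc f) i n s)) :=
    ⟨_, fun _ _ _ _ => rfl⟩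
  have hVc : ∀ f i n, Continuous (V f i n) := fun f i n => by
    rw [show V f i n = fun t => (if n₀ ≤ n then (1 : ℝ) else 0) * ((1 + ε₀) ^ ((20 : ℝ) * n) *
        (F i n t + ∫ s in a..t, k i n (t - s) * quadTerm ε₀ α (Xc f) i n s)) from funext (hV f i n)]
    refine continuous_const.mul (continuous_const.mul ((hFc i n).add ?_))
    have hj : Continuous (Function.uncurry fun t s : ℝ => k i n (t - s) * quadTerm ε₀ α (Xc f) i n s) :=
      ((hkc i n).comp (continuous_fst.sub continuous_snd)).mul
        ((continuous_quadTerm α (hXcc f) i n).comp continuous_snd)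
    exact intervalIntegral.continuous_parametric_intervalIntegral_of_continuous hj continuous_id
  have hVb : ∀ f i n, ∀ t ∈ Icc a b, |V f i n t| ≤ ρ := fun f i n t ht => by
    rw [hV]
    split_ifs with hn
    · rw [one_mul, abs_mul, abs_of_pos (Real.rpow_pos_of_pos hL0 _)]
      have hI := weighted_volterra_abs_le hε₀ α hρ0.le (hXcc f) (hXcb f)
        ((hkc i n).comp (continuous_const.sub continuous_id)) (fun s => hk1 i n (t - s)) i hn ht.1
        (by linarith [ht.2] : t - a ≤ δ)
      rw [← hK, ← hΛ] at hI
      have hI' := mul_le_mul_of_nonneg_right hδΛ hρ0.le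
      calc (1 + ε₀) ^ ((20 : ℝ) * n) * |F i n t + ∫ s in a..t, k i n (t - s) * quadTerm ε₀ α (Xc f) i n s|
          ≤ (1 + ε₀) ^ ((20 : ℝ) * n) * (|F i n t| +
              |∫ s in a..t, k i n (t - s) * quadTerm ε₀ α (Xc f) i n s|) :=
            mul_le_mul_of_nonneg_left (abs_add_le _ _) (Real.rpow_nonneg hL0.le _)
        _ ≤ R + δ * Λ * ρ := by rw [mul_add]; exact add_le_add (hFR i n t) hI
        _ ≤ ρ := by linarith
    · rw [zero_mul, abs_zero]
      exact hρ0.le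
  have hVd : ∀ f g i n, ∀ t ∈ Icc a b, |V f i n t - V g i n t| ≤ 1 / 2 * dist f g :=
    fun f g i n t ht => by
      rw [hV, hV]
      split_ifs with hn
      · rw [one_mul, one_mul, ← mul_sub, add_sub_add_left_eq_sub, abs_mul,
          abs_of_pos (Real.rpow_pos_of_pos hL0 _)]
        have hI := weighted_volterra_sub_le hε₀ α hρ0.le dist_nonneg (hXcc f) (hXcc g) (hXcb f) (hXcb g)
          (hXcd f g) ((hkc i n).comp (continuous_const.sub continuous_id)) (fun s => hk1 i n (t - s)) i hn
          ht.1 (by linarith [ht.2] : t - a ≤ δ)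
        rw [← hK, ← hΛ] at hI
        exact hI.trans (mul_le_mul_of_nonneg_right hδΛ dist_nonneg)
      · rw [zero_mul, zero_mul, sub_self, abs_zero]
        positivity
  -- the Picard map on the bounded continuous functions on `(Fin m × ℤ) × [a,b]`
  obtain ⟨Φ, hΦ⟩ : ∃ Φ : ((Fin m × ℤ) × Icc a b →ᵇ ℝ) → ((Fin m × ℤ) × Icc a b →ᵇ ℝ),
      ∀ f x, Φ f x = V f x.1.1 x.1.2 x.2 := by
    have hc : ∀ f : (Fin m × ℤ) × Icc a b →ᵇ ℝ,
        Continuous fun x : (Fin m × ℤ) × Icc a b => V f x.1.1 x.1.2 x.2 := fun f =>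
      continuous_prod_of_discrete_left.2 fun p => (hVc f p.1 p.2).comp continuous_subtype_val
    have hb' : ∀ (f : (Fin m × ℤ) × Icc a b →ᵇ ℝ) (x : (Fin m × ℤ) × Icc a b),
        ‖V f x.1.1 x.1.2 x.2‖ ≤ ρ := fun f x => by
      rw [Real.norm_eq_abs]
      exact hVb f _ _ _ x.2.2
    exact ⟨fun f => BoundedContinuousFunction.ofNormedAddCommGroup _ (hc f) ρ (hb' f), fun f x => rfl⟩
  have hΦK : ContractingWith (Real.toNNReal (1 / 2)) Φ := by
    refine ⟨Real.toNNReal_lt_one.2 (by norm_num), LipschitzWith.of_dist_le' fun f g => ?_⟩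
    refine (BoundedContinuousFunction.dist_le (by positivity)).2 fun x => ?_
    rw [hΦ, hΦ, Real.dist_eq]
    exact hVd f g _ _ _ x.2.2
  -- the fixed point and the solution it carries
  obtain ⟨f₀, hfix⟩ : ∃ f₀ : (Fin m × ℤ) × Icc a b →ᵇ ℝ, Φ f₀ = f₀ :=
    ⟨ContractingWith.fixedPoint Φ hΦK, hΦK.fixedPoint_isFixedPt⟩
  have hf₀V : ∀ (i : Fin m) (n : ℤ) (t : Icc a b), f₀ ((i, n), t) = V f₀ i n t := fun i n t => by
    have h := hΦ f₀ ((i, n), t)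
    rwa [hfix] at h
  have hf₀n : ‖f₀‖ ≤ ρ := by
    refine (BoundedContinuousFunction.norm_le hρ0.le).2 fun x => ?_
    rw [← hfix, hΦ, Real.norm_eq_abs]
    exact hVb _ _ _ _ x.2.2
  have hX0 : ∀ i n t, n < n₀ → Xc f₀ i n t = 0 := fun i n t hn => by
    rw [hXc, hf₀V, hV, if_neg (not_le.2 hn), zero_mul, hπid 0 (by rw [abs_zero]; exact hρ0.le),
      mul_zero]
  have hXeq : ∀ (i : Fin m) (n : ℤ), ∀ t ∈ Icc a b,
      Xc f₀ i n t = F i n t + ∫ s in a..t, k i n (t - s) * quadTerm ε₀ α (Xc f₀) i n s := by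
    intro i n t ht
    rcases lt_or_ge n n₀ with hn | hn
    · rw [hX0 i n t hn, hF0 i n t hn, zero_add]
      simp only [quadTerm_eq_zero_of_lt α hX0 i hn, mul_zero, intervalIntegral.integral_zero]
    · rw [hXcid f₀ hf₀n i n t ht, hf₀V, hV, if_pos hn, one_mul, ← mul_assoc, ← Real.rpow_add hL0,
        neg_add_cancel, Real.rpow_zero, one_mul]
  refine ⟨Xc f₀, hXcc f₀, hX0, fun i n t => (weight_mul_abs_le_iff hL0 _ _ _).2 (hXcb f₀ i n t), hXeq,
    ?_⟩
  -- uniqueness: every solution of size `≤ ρ` is a fixed point of `Φ`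
  intro Z hZc hZ0 hZb hZeq
  have hcZ : Continuous fun x : (Fin m × ℤ) × Icc a b =>
      (1 + ε₀) ^ ((20 : ℝ) * x.1.2) * Z x.1.1 x.1.2 x.2 :=
    continuous_prod_of_discrete_left.2 fun p =>
      ((continuous_const (y := (1 + ε₀) ^ ((20 : ℝ) * p.2))).mul (hZc p.1 p.2).restrict).congr
        fun _ => rfl
  have hbZ : ∀ x : (Fin m × ℤ) × Icc a b, ‖(1 + ε₀) ^ ((20 : ℝ) * x.1.2) * Z x.1.1 x.1.2 x.2‖ ≤ ρ :=
    fun x => by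
      rw [Real.norm_eq_abs, abs_mul, abs_of_pos (Real.rpow_pos_of_pos hL0 _)]
      exact hZb _ _ _ x.2.2
  set fZ := BoundedContinuousFunction.ofNormedAddCommGroup _ hcZ ρ hbZ with hfZ
  have hfZn : ‖fZ‖ ≤ ρ := BoundedContinuousFunction.norm_ofNormedAddCommGroup_le _ hρ0.le _
  have hfZapp : ∀ (j : Fin m) (k' : ℤ) (s : Icc a b),
      fZ ((j, k'), s) = (1 + ε₀) ^ ((20 : ℝ) * k') * Z j k' s := fun _ _ _ => rfl
  have hXcZ : ∀ (j : Fin m) (k' : ℤ), ∀ s ∈ Icc a b, Xc fZ j k' s = Z j k' s := fun j k' s hs => by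
    rw [hXcid fZ hfZn j k' s hs, hfZapp, ← mul_assoc, ← Real.rpow_add hL0, neg_add_cancel,
      Real.rpow_zero, one_mul]
  have hfix' : Φ fZ = fZ := by
    ext x
    obtain ⟨⟨i, n⟩, ⟨t, ht⟩⟩ := x
    rw [hΦ, hfZapp]
    show V fZ i n t = (1 + ε₀) ^ ((20 : ℝ) * n) * Z i n t
    rw [hV]
    rcases lt_or_ge n n₀ with hn | hn
    · rw [if_neg (not_le.2 hn), zero_mul, hZ0 i n t hn, mul_zero]
    · rw [if_pos hn, one_mul, hZeq i n t ht]
      have hI : ∫ s in a..t, k i n (t - s) * quadTerm ε₀ α (Xc fZ) i n s =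
          ∫ s in a..t, k i n (t - s) * quadTerm ε₀ α Z i n s :=
        intervalIntegral.integral_congr fun s hs => by
          rw [uIcc_of_le ht.1] at hs
          show k i n (t - s) * quadTerm ε₀ α (Xc fZ) i n s = k i n (t - s) * quadTerm ε₀ α Z i n s
          rw [quadTerm_congr_at α (fun j k' => hXcZ j k' s ⟨hs.1, hs.2.trans ht.2⟩) i n]
      rw [hI]
  have hEq : fZ = f₀ := hΦK.fixedPoint_unique' hfix' hfix
  intro i n t ht
  rw [← hXcZ i n t ht, hEq]

end Summit.NavierStokesRegularity.NavierStokesRegularity.Theorems.PerpetualPumpAveragedTypeIBlowup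

end
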